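import Summits.QuantumFields.BalabanUV.Beta.FP.TorusOneShotColumnGaugeProj
import Summits.QuantumFields.BalabanUV.Beta.FP.NestedStepLawTorusCompositeOneShotTopGB

/-!
# `BalabanUV.Beta.FP.TorusOneShotColumnGaugeProjG` — road «FP» for binder row D1, ROUTE T (β1), J-RISK-1 LOCATED (Q-FP-39-1), THE RECORD HALF AT THE `-G` DOOR:
# **AT #21-GB's PINS AND DISPLAYED BRICK INPUTS, the one-shot N column IS the gauge projection of the nested direction** —
# `XN₁₂·(v,0) = hv v − W₀·((P·W₀)⁻¹·(P·hv v))` with `h1 h2 b0 hPW` DERIVED INSIDE exactly as #21-GB derives them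

WHY.  `TorusOneShotColumnGaugeProj.XN_toBlocks₁₂_mulVec_eq_gaugeProj` displays seven side letters (`a0 hH₀t b0 hTW hPW h1 h2`).  At the `-G` door
(`NestedStepLawTorusCompositeOneShotTopGB.secondVar_oneShot_nestedStepLaw_torus_composite_graded_oneShot_of_uTop_G`, the theorem `TowerKernelLawGB ∕ SymB ∕ NamedB`
read BY TERM) four of them are NOT displayed but derived: the fine one-shot (INV) `h1` and the coarse sliced (INV) `h2` from leaf-05's
`TorusEffFormCompositeGB.torus_composite_inv_and_eff_G` (`hone hId`) carried across the LOWER slice change (`hSL`, leaf-06 `det_bigP_mul_towerGen_ne_zero`,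
an2's Literature `isUnit_det_kkt_sliceChange₃ ∕ blocks_sliceChange₃`) and the top comb-KKT `htop`; `b0 = 𝔔₀W₀ = 0` from `c0 d0 h𝔔₀` (`compWard_b0`); `hPW` from
leaf-06's unimodularity one level up.  THIS FILE repeats that derivation VERBATIM (the `-G` door's own proof lines) and concludes the gauge-projection identity
with EXACTLY the `-G` door's pins (`hH₀ hQ₁₀ hτ₁ hW₀ hP`; `τ₂ Dbar` free — their pins `hτ₂ hDbar` are not needed) and displayed brick inputs (`hH₀t hone hId hSL htop a0 c0 d0 hTW`) plus the wrapper's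
namings (`hI hS hhv h𝔔₀ hXN`) — so the SymB ∕ NamedB instantiations that already feed #21-GB feed this theorem with the same terms, no new letter.

WHAT ([folklore] ONE instantiation BY NAME; no `def`, no `def … : Prop`, nothing cited, 0 sorry): **`XN_toBlocks₁₂_mulVec_eq_gaugeProj_G`** and its bond-wise
reading **`XN_inl_inr_inl_sum_eq_G`**.  WHAT THIS IS NOT: not the SymB ∕ NamedB instance lines (mechanical, with the next wrapper version), not `lv`'s site
function, not (J-X), not (J-Λ); no row of the END wrapper discharged; nothing of Bałaban's asserted, valued or discharged; 0 estimates; 0∕4 row-D1 binders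
(hW, hR, D1Tel, D1Rep); ROOT M‴ p325680 untouched; NOT (C1), NOT (L2′), NOT (T-ID), NOT SDF, NOT D1, NOT BetaPertH, NOT continuum, NOT Clay.

HONEST DEPENDENCY (page 1, mandatory): continuum YM on T⁴ ⇐ BetaPertH ∧ nine spine estimates (0/9 proved); BetaPertH ⇐ (D1) ∧ (D4) ∧ CAP+tail;
G-an2-4 gates asym, D1 and NE2/3/4.  HONEST FRAMING (cell contract, verbatim): «discharging `BetaPertH` makes Bałaban's UV stability UNCONDITIONAL —
a real constructive-QFT result; it is NOT the continuum limit and NOT the Clay problem.»  ABSOLUTE RULE (cell charter, verbatim): «No internally-minted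
statement may enter as a cited fact. Every hypothesis is either kernel-proved in this package or a verbatim quotation of a PUBLISHED theorem with page
reference. The manuscript(s) under audit are NOT citable for their own disputed steps — they are the thing under adjudication; programme-internal
(2001/route/tribunal) claims are never citable.»  Road «FP» OWNER, b2b-balaban-beta-d1-p3 gen 39, 2026-08-27.  No existing file touched.
-/

noncomputable section

namespace Summit.QuantumFields.BalabanUV.Beta.FP.TorusOneShotColumnGaugeProjG

open Matrix Finset
open Literature.MathematicalPhysics.QuantumFieldTheory.Balaban1983to89
open Literature.MathematicalPhysics.QuantumFieldTheory.Balaban1983to89.Beta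
open Literature.MathematicalPhysics.QuantumFieldTheory.Balaban1983to89.Beta.Composition (kkt)
open Literature.MathematicalPhysics.QuantumFieldTheory.Balaban1983to89.Beta.CompositionSingular (effForm minOp)
open Literature.MathematicalPhysics.QuantumFieldTheory.Balaban1983to89.Beta.GaugeFixingPropagators (isUnit_det_kkt_sliceChange₃ blocks_sliceChange₃)
open B5Prop11Plancherel (fine)
open B6Lemma24Torus (pbox)
open AffineAveraging (Site box toSite)
open OneStepResolventKernel (Fib)
open ExpKernelCalculus (MKer)
open BalabanStepJetsSucc (wVH)
open Summit.QuantumFields.BalabanUV.Beta.BorderedHessian (stepScale)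
open Summit.QuantumFields.BalabanUV.Beta.FP.KernelPeriodisationFib (Idx perF)
open Summit.QuantumFields.BalabanUV.Beta.FP.TorusCombRows (Res)
open Summit.QuantumFields.BalabanUV.Beta.FP.TorusGaugeCovariance (tgrad)
open Summit.QuantumFields.BalabanUV.Beta.FP.TorusCompositeObjects (towerTorus NParam combF bigP towerGen bigRoot bigRatio towerEquiv)
open Summit.QuantumFields.BalabanUV.Beta.FP.TorusCompositeObjectsG (StepRows compRowsG nestedSliceG)
open Summit.QuantumFields.BalabanUV.Beta.FP.TorusCompositeUnimodular (det_bigP_mul_towerGen_ne_zero towerEvalC)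
open Summit.QuantumFields.BalabanUV.Beta.FP.TorusCompositeIntertwining (towerGen_eq_point_mul)
open Summit.QuantumFields.BalabanUV.Beta.FP.TorusEffFormCompositeGB (torus_composite_inv_and_eff_G)
open Summit.QuantumFields.BalabanUV.Beta.FP.CompositeWardLetters (compWard_b0)
open Summit.QuantumFields.BalabanUV.Beta.FP.RelInvPeriodisedCoarse (det_kkt_smul_form_ne_zero_iff)
open Summit.QuantumFields.BalabanUV.Beta.FP.RelInvPeriodisedEffFormCoarse (wVH_pos)
open Summit.QuantumFields.BalabanUV.Beta.FP.NestedStepLawTorusInstance (dvd_fine)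
open Summit.QuantumFields.BalabanUV.Beta.GAN24.FineReadoutCauchyFrame (toSite_mem_range)
open Summit.QuantumFields.BalabanUV.Beta.FP.TorusOneShotColumnGaugeProj (XN_toBlocks₁₂_mulVec_eq_gaugeProj)

variable {d : ℕ}

/-! ## §1 Every tower mode is exact: `towerGen · θ = tgrad · λ̂θ` -/

section Exact

variable (Lc : ℕ) [NeZero Lc]

/-- [folklore] **EVERY TOWER MODE IS EXACT**: `(towerGen · θ) b = Σ_s tgrad T (b.1, inl b.2) s · λ̂ s` with the SITE FUNCTION
`λ̂ s := Σ_{x : big-comb residual sites} [x.1 = s] · (towerEvalC · θ) (towerEquiv x)` (the value at `s` of the superposition `θ` of nested modes; `0` at the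
big-comb roots) — leaf-06's `TorusCompositeIntertwining.towerGen_eq_point_mul` (`towerGen = (tgrad ∣ point modes, sorted) · towerEvalC`) read on a vector.
This is #21's `h + Σ_s tgrad T (b.1, inl b.2) s · lam s` currency for the exact part of a direction. -/
theorem towerGen_mulVec_apply_eq_tgrad (M : Fin (d + 1) → ℕ) [∀ μ, NeZero (M μ)] (rs : ℕ → (Fin (d + 1) → ℕ))
    (hrs : ∀ k i, 0 ≤ toSite (rs k) i ∧ toSite (rs k) i < (Lc : ℤ)) (n : ℕ) (θ : NParam Lc M rs n → ℝ)
    (b : ↥(pbox (towerTorus Lc M n)) × Fin (d + 1)) :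
    (towerGen Lc M rs n *ᵥ θ) b
      = ∑ s : ↥(pbox (towerTorus Lc M n)), tgrad (towerTorus Lc M n) (b.1, Sum.inl b.2) s *
          ∑ x : Res (bigRoot Lc rs n) (bigRatio Lc n) (towerTorus Lc M n),
            (if (x.1 : ↥(pbox (towerTorus Lc M n))) = s then (towerEvalC Lc M rs hrs n *ᵥ θ) (towerEquiv Lc M rs hrs n x) else 0) := by
  set u : NParam Lc M rs n → ℝ := towerEvalC Lc M rs hrs n *ᵥ θ with hu
  rw [towerGen_eq_point_mul Lc M rs hrs n, ← mulVec_mulVec, ← hu, Matrix.submatrix_mulVec_equiv, Equiv.symm_symm]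
  simp only [Function.comp_apply, id, mulVec, dotProduct, submatrix_apply]
  simp_rw [Finset.mul_sum, mul_ite, mul_zero]
  rw [Finset.sum_comm]
  refine Finset.sum_congr rfl ?_
  intro x _
  rw [Finset.sum_ite_eq Finset.univ (x.1 : ↥(pbox (towerTorus Lc M n)))]
  simp only [Finset.mem_univ, if_true]

/-- [folklore] … hence a column that differs from `h` by a tower mode, `h − towerGen·θ`, is `h` TRANSPORTED in #21's currency:
`(h − towerGen·θ) b = h b + Σ_s tgrad T (b.1, inl b.2) s · lam s` with `lam := −λ̂θ` — the shape of #21's one-shot generator-jet weight `hW'₁`. -/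
theorem sub_towerGen_mulVec_apply (M : Fin (d + 1) → ℕ) [∀ μ, NeZero (M μ)] (rs : ℕ → (Fin (d + 1) → ℕ))
    (hrs : ∀ k i, 0 ≤ toSite (rs k) i ∧ toSite (rs k) i < (Lc : ℤ)) (n : ℕ) (θ : NParam Lc M rs n → ℝ)
    (h : ↥(pbox (towerTorus Lc M n)) × Fin (d + 1) → ℝ) (b : ↥(pbox (towerTorus Lc M n)) × Fin (d + 1)) :
    (h - towerGen Lc M rs n *ᵥ θ) b
      = h b + ∑ s : ↥(pbox (towerTorus Lc M n)), tgrad (towerTorus Lc M n) (b.1, Sum.inl b.2) s *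
          -(∑ x : Res (bigRoot Lc rs n) (bigRatio Lc n) (towerTorus Lc M n),
            (if (x.1 : ↥(pbox (towerTorus Lc M n))) = s then (towerEvalC Lc M rs hrs n *ᵥ θ) (towerEquiv Lc M rs hrs n x) else 0)) := by
  rw [Pi.sub_apply, towerGen_mulVec_apply_eq_tgrad Lc M rs hrs n θ b, sub_eq_add_neg, ← Finset.sum_neg_distrib]
  simp_rw [mul_neg]

end Exact

/-! ## §2 At the `-G` door's pins -/

section RecordG

variable (M' : Fin (d + 1) → ℕ) [∀ μ, NeZero (M' μ)] (Lc : ℕ) [NeZero Lc] (lev : ℕ → ℕ) (rs : ℕ → (Fin (d + 1) → ℕ)) (n : ℕ)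

set_option synthInstance.maxSize 1024 in
/-- [folklore] **`XN_toBlocks₁₂_mulVec_eq_gaugeProj_G` — THE ONE-SHOT N COLUMN IS THE GAUGE PROJECTION OF THE NESTED DIRECTION, AT THE `-G` DOOR's PINS.**
Binders = #21-GB's (`Q K hrs hlev hM′`, the top multiplier type `κ`, pins `hH₀ hQ₁₀ hτ₁ hW₀ hP` (`τ₂ Dbar` free), displayed brick inputs `hH₀t hone hId hSL htop a0 c0 d0 hTW`,
namings `h𝔔₀ hI hS`) VERBATIM, plus the wrapper's nested direction `hhv` and one-shot right inverse `hXN`.  CONCLUSION: for every top source `v`,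
`XN.toBlocks₁₂ · (v, 0) = hv v − W₀·((P·W₀)⁻¹·(P·hv v))`.  Inside: `h1 h2` as in #21-GB (leaf-05's `torus_composite_inv_and_eff_G` across the lower slice change),
`b0 := compWard_b0 c0 d0 h𝔔₀`, `hPW := det_bigP_mul_towerGen_ne_zero` one level up; then `TorusOneShotColumnGaugeProj.XN_toBlocks₁₂_mulVec_eq_gaugeProj`. -/
theorem XN_toBlocks₁₂_mulVec_eq_gaugeProj_G (Q : StepRows d Lc) (K : ℕ → (Fin (d + 1) → ℕ) → MKer (d + 1) (Fib d)) (hrs : ∀ k, rs k ∈ box (d + 1) Lc)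
    (hlev : ∀ i, i ≤ n → lev i = lev (i + 1) + 1) (hM' : ∀ i, Lc ∣ M' i)
    {κ : Type*} [Fintype κ] [DecidableEq κ]
    {H₀ : Matrix (↥(pbox (towerTorus Lc M' (n + 1))) × Fin (d + 1)) (↥(pbox (towerTorus Lc M' (n + 1))) × Fin (d + 1)) ℝ}
    {Q₁₀ : Matrix (↥(pbox M') × Fin (d + 1)) (↥(pbox (towerTorus Lc M' (n + 1))) × Fin (d + 1)) ℝ}
    {τ₁ : Matrix (NParam Lc (fine Lc M') (fun k => rs (k + 1)) n) (↥(pbox (towerTorus Lc M' (n + 1))) × Fin (d + 1)) ℝ}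
    (hH₀ : H₀ = (perF (towerTorus Lc M' (n + 1)) (K (lev (n + 1)) (rs (n + 1)))).submatrix
        (fun b : ↥(pbox (towerTorus Lc M' (n + 1))) × Fin (d + 1) => ((b.1, Sum.inl b.2) : Idx (towerTorus Lc M' (n + 1)) (Fib d)))
        (fun b : ↥(pbox (towerTorus Lc M' (n + 1))) × Fin (d + 1) => ((b.1, Sum.inl b.2) : Idx (towerTorus Lc M' (n + 1)) (Fib d))))
    (hQ₁₀ : Q₁₀ = compRowsG Lc Q M' lev rs (n + 1))
    (hτ₁ : τ₁ = bigP Lc (fine Lc M') (fun k => rs (k + 1)) (fun k => toSite_mem_range (hrs (k + 1))) n)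
    (hH₀t : H₀ᵀ = H₀)
    (hone : ∀ (k : ℕ) (T : Fin (d + 1) → ℕ) [∀ μ, NeZero (T μ)],
      (kkt ((perF (fine Lc T) (K (lev k) (rs k))).submatrix
            (fun b : ↥(pbox (fine Lc T)) × Fin (d + 1) => ((b.1, Sum.inl b.2) : Idx (fine Lc T) (Fib d)))
            (fun b : ↥(pbox (fine Lc T)) × Fin (d + 1) => ((b.1, Sum.inl b.2) : Idx (fine Lc T) (Fib d))))
        (fromRows (Q T (lev k) (rs k)) (combF Lc (fine Lc T) (rs k)))).det ≠ 0)
    (hId : ∀ (k : ℕ) (T : Fin (d + 1) → ℕ) [∀ μ, NeZero (T μ)] (r' : Fin (d + 1) → ℕ),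
      (effForm ((perF (fine Lc T) (K (lev k) (rs k))).submatrix
            (fun b : ↥(pbox (fine Lc T)) × Fin (d + 1) => ((b.1, Sum.inl b.2) : Idx (fine Lc T) (Fib d)))
            (fun b : ↥(pbox (fine Lc T)) × Fin (d + 1) => ((b.1, Sum.inl b.2) : Idx (fine Lc T) (Fib d))))
          (fromRows (Q T (lev k) (rs k)) (combF Lc (fine Lc T) (rs k)))).toBlocks₁₁
        = (wVH d Lc (lev k + 1))⁻¹ • (perF T (K (lev k + 1) r')).submatrix
            (fun b : ↥(pbox T) × Fin (d + 1) => ((b.1, Sum.inl b.2) : Idx T (Fib d)))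
            (fun b : ↥(pbox T) × Fin (d + 1) => ((b.1, Sum.inl b.2) : Idx T (Fib d))))
    (hSL : (nestedSliceG Lc Q (fine Lc M') (fun k => lev (k + 1)) (fun k => rs (k + 1)) n
        * towerGen Lc (fine Lc M') (fun k => rs (k + 1)) n).det ≠ 0)
    {τ₂ : Matrix (Res (toSite (rs 0)) Lc M') (↥(pbox M') × Fin (d + 1)) ℝ}
    (Q₂₀ : Matrix κ (↥(pbox M') × Fin (d + 1)) ℝ)
    (htop : (kkt ((perF M' (K (lev 0) (rs 0))).submatrix (fun b : ↥(pbox M') × Fin (d + 1) => ((b.1, Sum.inl b.2) : Idx M' (Fib d)))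
        (fun b : ↥(pbox M') × Fin (d + 1) => ((b.1, Sum.inl b.2) : Idx M' (Fib d)))) (fromRows Q₂₀ τ₂)).det ≠ 0)
    {W₀ : Matrix (↥(pbox (towerTorus Lc M' (n + 1))) × Fin (d + 1)) (NParam Lc M' rs (n + 1)) ℝ} (hW₀ : W₀ = towerGen Lc M' rs (n + 1))
    {P : Matrix (NParam Lc M' rs (n + 1)) (↥(pbox (towerTorus Lc M' (n + 1))) × Fin (d + 1)) ℝ} (hP : P = bigP Lc M' rs (fun k => toSite_mem_range (hrs k)) (n + 1))
    {Dbar : Matrix (↥(pbox M') × Fin (d + 1)) (Res (toSite (rs 0)) Lc M') ℝ}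
    (c0 : Q₁₀ * W₀ = fromCols Dbar (0 : Matrix (↥(pbox M') × Fin (d + 1)) (NParam Lc (fine Lc M') (fun k => rs (k + 1)) n) ℝ))
    (hTW : (Matrix.fromRows (τ₂ * Q₁₀) τ₁ * W₀).det ≠ 0)
    (d0 : Q₂₀ * Dbar = 0)
    (a0 : H₀ * W₀ = 0)
    {𝔔₀ : Matrix κ (↥(pbox (towerTorus Lc M' (n + 1))) × Fin (d + 1)) ℝ} (h𝔔₀ : Q₂₀ * Q₁₀ = 𝔔₀)
    {I : Matrix (↥(pbox (towerTorus Lc M' (n + 1))) × Fin (d + 1)) ((↥(pbox M') × Fin (d + 1)) ⊕ NParam Lc (fine Lc M') (fun k => rs (k + 1)) n) ℝ}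
    {S : Matrix ((↥(pbox M') × Fin (d + 1)) ⊕ NParam Lc (fine Lc M') (fun k => rs (k + 1)) n)
      ((↥(pbox M') × Fin (d + 1)) ⊕ NParam Lc (fine Lc M') (fun k => rs (k + 1)) n) ℝ}
    (hI : minOp H₀ (fromRows Q₁₀ τ₁) = I) (hS : effForm H₀ (fromRows Q₁₀ τ₁) = S)
    -- the wrapper's NESTED direction (`hhv`, leaf-06 G-5's `h`) and its ONE-SHOT N system's right inverse (`hXN`)
    {hv : (κ → ℝ) → ((↥(pbox (towerTorus Lc M' (n + 1))) × Fin (d + 1)) → ℝ)}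
    (hhv : ∀ v, hv v = I *ᵥ Sum.elim (minOp S.toBlocks₁₁ (fromRows Q₂₀ τ₂) *ᵥ Sum.elim v 0) 0)
    {XN : Matrix ((↥(pbox (towerTorus Lc M' (n + 1))) × Fin (d + 1)) ⊕ (κ ⊕ NParam Lc M' rs (n + 1)))
      ((↥(pbox (towerTorus Lc M' (n + 1))) × Fin (d + 1)) ⊕ (κ ⊕ NParam Lc M' rs (n + 1))) ℝ}
    (hXN : kkt H₀ (fromRows 𝔔₀ P) * XN = 1) (v : κ → ℝ) :
    XN.toBlocks₁₂ *ᵥ Sum.elim v 0 = hv v - W₀ *ᵥ ((P * W₀)⁻¹ *ᵥ (P *ᵥ hv v)) := by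
  have hL0 : 0 < Lc := Nat.pos_of_ne_zero (NeZero.ne Lc)
  -- leaf-05's GENERIC nested (INV) ∧ (EFF) from the displayed one-step letters
  have hIE := torus_composite_inv_and_eff_G Lc Q K n M' lev rs hlev hone hId
  obtain ⟨τn, hτn⟩ : ∃ τn : Matrix (NParam Lc (fine Lc M') (fun k => rs (k + 1)) n) (↥(pbox (towerTorus Lc M' (n + 1))) × Fin (d + 1)) ℝ,
      τn = nestedSliceG Lc Q (fine Lc M') (fun k => lev (k + 1)) (fun k => rs (k + 1)) n := ⟨_, rfl⟩
  obtain ⟨Wl, hWl⟩ : ∃ Wl : Matrix (↥(pbox (towerTorus Lc M' (n + 1))) × Fin (d + 1)) (NParam Lc (fine Lc M') (fun k => rs (k + 1)) n) ℝ,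
      Wl = towerGen Lc (fine Lc M') (fun k => rs (k + 1)) n := ⟨_, rfl⟩
  -- `W₀ = fromCols D_top Wl` (`towerGen_succ`, `rfl`): the lower generators are the right column block of `W₀`
  have hW2 : W₀.toCols₂ = Wl := by
    rw [hWl, hW₀]
    exact Matrix.toCols₂_fromCols _ _
  have hKW : H₀ * Wl = 0 := by
    have h0 : H₀ * Matrix.fromCols W₀.toCols₁ W₀.toCols₂ = 0 := by rw [Matrix.fromCols_toCols]; exact a0
    rw [Matrix.mul_fromCols, ← Matrix.fromCols_zero] at h0
    rw [← hW2]
    exact (Matrix.fromCols_inj h0).2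
  have hKtW : H₀ᵀ * Wl = 0 := by rw [hH₀t]; exact hKW
  have hQW : Q₁₀ * Wl = 0 := by
    have h0 : Q₁₀ * Matrix.fromCols W₀.toCols₁ W₀.toCols₂
        = Matrix.fromCols Dbar (0 : Matrix (↥(pbox M') × Fin (d + 1)) (NParam Lc (fine Lc M') (fun k => rs (k + 1)) n) ℝ) := by
      rw [Matrix.fromCols_toCols]; exact c0
    rw [Matrix.mul_fromCols] at h0
    rw [← hW2]
    exact (Matrix.fromCols_inj h0).2
  have hT : (τn * Wl).det ≠ 0 := by
    rw [hτn, hWl]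
    exact hSL
  have hSW : (τ₁ * Wl).det ≠ 0 := by
    rw [hτ₁, hWl]
    exact det_bigP_mul_towerGen_ne_zero Lc (fine Lc M') (fun k => rs (k + 1)) (fun k => toSite_mem_range (hrs (k + 1))) (dvd_fine M') n
  have hτn1 : (kkt H₀ (fromRows Q₁₀ τn)).det ≠ 0 := by
    rw [hH₀, hQ₁₀, hτn]; exact hIE.1
  -- (INV) ∧ (EFF) ACROSS THE LOWER SLICE CHANGE (an2's Literature `GaugeFixingPropagators` §3c, three blocks) — #21-GB's lines
  have h1 : (kkt H₀ (fromRows Q₁₀ τ₁)).det ≠ 0 :=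
    (isUnit_det_kkt_sliceChange₃ H₀ Q₁₀ τn τ₁ Wl hKW hKtW hQW (isUnit_iff_ne_zero.2 hT) (isUnit_iff_ne_zero.2 hSW)
      (isUnit_iff_ne_zero.2 hτn1)).ne_zero
  have hEff : (effForm H₀ (fromRows Q₁₀ τ₁)).toBlocks₁₁ = (effForm H₀ (fromRows Q₁₀ τn)).toBlocks₁₁ := by
    rw [(blocks_sliceChange₃ H₀ Q₁₀ τn τ₁ Wl hKW hKtW hQW (isUnit_iff_ne_zero.2 hT) (isUnit_iff_ne_zero.2 hSW)
      (isUnit_iff_ne_zero.2 hτn1)).2.2.2, toBlocks_fromBlocks₁₁]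
  have hc : (∏ i ∈ range (n + 1), (wVH d Lc (lev i))⁻¹) ≠ 0 :=
    prod_ne_zero_iff.mpr fun i _ => inv_ne_zero (wVH_pos hL0 (lev i)).ne'
  have h2 : (kkt S.toBlocks₁₁ (fromRows Q₂₀ τ₂)).det ≠ 0 := by
    rw [← hS, hEff, hH₀, hQ₁₀, hτn, hIE.2 (rs 0), det_kkt_smul_form_ne_zero_iff hc]
    exact htop
  -- the composite averaging kills every tower generator; the one-shot big comb is transversal one level up
  have b0 := compWard_b0 Q₁₀ Q₂₀ W₀ Dbar c0 d0 h𝔔₀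
  have hPW : (P * W₀).det ≠ 0 := by
    rw [hP, hW₀]
    exact det_bigP_mul_towerGen_ne_zero Lc M' rs (fun k => toSite_mem_range (hrs k)) hM' (n + 1)
  exact XN_toBlocks₁₂_mulVec_eq_gaugeProj hI hS hhv h𝔔₀ hXN a0 hH₀t b0 hTW hPW h1 h2 v

set_option synthInstance.maxSize 1024 in
/-- [folklore] **BOND-WISE READING AT THE `-G` DOOR's PINS**: `Σ_a XN (inl b) (inr (inl a)) · v a = hv v b − (W₀·((P·W₀)⁻¹·(P·hv v))) b` — the `12` block the N leg
`hLN` reads, against the nested direction the H-side reads (`hbtop : hb (n+1) v = hv v`). -/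
theorem XN_inl_inr_inl_sum_eq_G (Q : StepRows d Lc) (K : ℕ → (Fin (d + 1) → ℕ) → MKer (d + 1) (Fib d)) (hrs : ∀ k, rs k ∈ box (d + 1) Lc)
    (hlev : ∀ i, i ≤ n → lev i = lev (i + 1) + 1) (hM' : ∀ i, Lc ∣ M' i)
    {κ : Type*} [Fintype κ] [DecidableEq κ]
    {H₀ : Matrix (↥(pbox (towerTorus Lc M' (n + 1))) × Fin (d + 1)) (↥(pbox (towerTorus Lc M' (n + 1))) × Fin (d + 1)) ℝ}
    {Q₁₀ : Matrix (↥(pbox M') × Fin (d + 1)) (↥(pbox (towerTorus Lc M' (n + 1))) × Fin (d + 1)) ℝ}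
    {τ₁ : Matrix (NParam Lc (fine Lc M') (fun k => rs (k + 1)) n) (↥(pbox (towerTorus Lc M' (n + 1))) × Fin (d + 1)) ℝ}
    (hH₀ : H₀ = (perF (towerTorus Lc M' (n + 1)) (K (lev (n + 1)) (rs (n + 1)))).submatrix
        (fun b : ↥(pbox (towerTorus Lc M' (n + 1))) × Fin (d + 1) => ((b.1, Sum.inl b.2) : Idx (towerTorus Lc M' (n + 1)) (Fib d)))
        (fun b : ↥(pbox (towerTorus Lc M' (n + 1))) × Fin (d + 1) => ((b.1, Sum.inl b.2) : Idx (towerTorus Lc M' (n + 1)) (Fib d))))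
    (hQ₁₀ : Q₁₀ = compRowsG Lc Q M' lev rs (n + 1))
    (hτ₁ : τ₁ = bigP Lc (fine Lc M') (fun k => rs (k + 1)) (fun k => toSite_mem_range (hrs (k + 1))) n)
    (hH₀t : H₀ᵀ = H₀)
    (hone : ∀ (k : ℕ) (T : Fin (d + 1) → ℕ) [∀ μ, NeZero (T μ)],
      (kkt ((perF (fine Lc T) (K (lev k) (rs k))).submatrix
            (fun b : ↥(pbox (fine Lc T)) × Fin (d + 1) => ((b.1, Sum.inl b.2) : Idx (fine Lc T) (Fib d)))
            (fun b : ↥(pbox (fine Lc T)) × Fin (d + 1) => ((b.1, Sum.inl b.2) : Idx (fine Lc T) (Fib d))))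
        (fromRows (Q T (lev k) (rs k)) (combF Lc (fine Lc T) (rs k)))).det ≠ 0)
    (hId : ∀ (k : ℕ) (T : Fin (d + 1) → ℕ) [∀ μ, NeZero (T μ)] (r' : Fin (d + 1) → ℕ),
      (effForm ((perF (fine Lc T) (K (lev k) (rs k))).submatrix
            (fun b : ↥(pbox (fine Lc T)) × Fin (d + 1) => ((b.1, Sum.inl b.2) : Idx (fine Lc T) (Fib d)))
            (fun b : ↥(pbox (fine Lc T)) × Fin (d + 1) => ((b.1, Sum.inl b.2) : Idx (fine Lc T) (Fib d))))
          (fromRows (Q T (lev k) (rs k)) (combF Lc (fine Lc T) (rs k)))).toBlocks₁₁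
        = (wVH d Lc (lev k + 1))⁻¹ • (perF T (K (lev k + 1) r')).submatrix
            (fun b : ↥(pbox T) × Fin (d + 1) => ((b.1, Sum.inl b.2) : Idx T (Fib d)))
            (fun b : ↥(pbox T) × Fin (d + 1) => ((b.1, Sum.inl b.2) : Idx T (Fib d))))
    (hSL : (nestedSliceG Lc Q (fine Lc M') (fun k => lev (k + 1)) (fun k => rs (k + 1)) n
        * towerGen Lc (fine Lc M') (fun k => rs (k + 1)) n).det ≠ 0)
    {τ₂ : Matrix (Res (toSite (rs 0)) Lc M') (↥(pbox M') × Fin (d + 1)) ℝ}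
    (Q₂₀ : Matrix κ (↥(pbox M') × Fin (d + 1)) ℝ)
    (htop : (kkt ((perF M' (K (lev 0) (rs 0))).submatrix (fun b : ↥(pbox M') × Fin (d + 1) => ((b.1, Sum.inl b.2) : Idx M' (Fib d)))
        (fun b : ↥(pbox M') × Fin (d + 1) => ((b.1, Sum.inl b.2) : Idx M' (Fib d)))) (fromRows Q₂₀ τ₂)).det ≠ 0)
    {W₀ : Matrix (↥(pbox (towerTorus Lc M' (n + 1))) × Fin (d + 1)) (NParam Lc M' rs (n + 1)) ℝ} (hW₀ : W₀ = towerGen Lc M' rs (n + 1))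
    {P : Matrix (NParam Lc M' rs (n + 1)) (↥(pbox (towerTorus Lc M' (n + 1))) × Fin (d + 1)) ℝ} (hP : P = bigP Lc M' rs (fun k => toSite_mem_range (hrs k)) (n + 1))
    {Dbar : Matrix (↥(pbox M') × Fin (d + 1)) (Res (toSite (rs 0)) Lc M') ℝ}
    (c0 : Q₁₀ * W₀ = fromCols Dbar (0 : Matrix (↥(pbox M') × Fin (d + 1)) (NParam Lc (fine Lc M') (fun k => rs (k + 1)) n) ℝ))
    (hTW : (Matrix.fromRows (τ₂ * Q₁₀) τ₁ * W₀).det ≠ 0)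
    (d0 : Q₂₀ * Dbar = 0)
    (a0 : H₀ * W₀ = 0)
    {𝔔₀ : Matrix κ (↥(pbox (towerTorus Lc M' (n + 1))) × Fin (d + 1)) ℝ} (h𝔔₀ : Q₂₀ * Q₁₀ = 𝔔₀)
    {I : Matrix (↥(pbox (towerTorus Lc M' (n + 1))) × Fin (d + 1)) ((↥(pbox M') × Fin (d + 1)) ⊕ NParam Lc (fine Lc M') (fun k => rs (k + 1)) n) ℝ}
    {S : Matrix ((↥(pbox M') × Fin (d + 1)) ⊕ NParam Lc (fine Lc M') (fun k => rs (k + 1)) n)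
      ((↥(pbox M') × Fin (d + 1)) ⊕ NParam Lc (fine Lc M') (fun k => rs (k + 1)) n) ℝ}
    (hI : minOp H₀ (fromRows Q₁₀ τ₁) = I) (hS : effForm H₀ (fromRows Q₁₀ τ₁) = S)
    {hv : (κ → ℝ) → ((↥(pbox (towerTorus Lc M' (n + 1))) × Fin (d + 1)) → ℝ)}
    (hhv : ∀ v, hv v = I *ᵥ Sum.elim (minOp S.toBlocks₁₁ (fromRows Q₂₀ τ₂) *ᵥ Sum.elim v 0) 0)
    {XN : Matrix ((↥(pbox (towerTorus Lc M' (n + 1))) × Fin (d + 1)) ⊕ (κ ⊕ NParam Lc M' rs (n + 1)))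
      ((↥(pbox (towerTorus Lc M' (n + 1))) × Fin (d + 1)) ⊕ (κ ⊕ NParam Lc M' rs (n + 1))) ℝ}
    (hXN : kkt H₀ (fromRows 𝔔₀ P) * XN = 1) (v : κ → ℝ) (b : ↥(pbox (towerTorus Lc M' (n + 1))) × Fin (d + 1)) :
    ∑ a : κ, XN (Sum.inl b) (Sum.inr (Sum.inl a)) * v a = hv v b - (W₀ *ᵥ ((P * W₀)⁻¹ *ᵥ (P *ᵥ hv v))) b := by
  have e := congrFun (XN_toBlocks₁₂_mulVec_eq_gaugeProj_G M' Lc lev rs n Q K hrs hlev hM' hH₀ hQ₁₀ hτ₁ hH₀t hone hId hSL Q₂₀ htop hW₀ hP c0 hTW d0 a0 h𝔔₀ hI hS hhv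
    hXN v) b
  rw [Pi.sub_apply] at e
  rw [← e]
  simp only [mulVec, dotProduct, Fintype.sum_sum_type, Sum.elim_inl, Sum.elim_inr, Pi.zero_apply, mul_zero, Finset.sum_const_zero, add_zero]
  rfl

end RecordG

end Summit.QuantumFields.BalabanUV.Beta.FP.TorusOneShotColumnGaugeProjG

end
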